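import Summits.BirchSwinnertonDyer.BirchSwinnertonDyer.Theorems.GenusKolyvaginAtTwoGenusPrimitiveSupplyAtTwoArchimedeanFrame
import Summits.BirchSwinnertonDyer.BirchSwinnertonDyer.Theorems.GenusKolyvaginAtTwoGenusPrimitiveSupplyAtTwoArchimedeanLevelLaw
import Summits.BirchSwinnertonDyer.BirchSwinnertonDyer.Theorems.GenusKolyvaginAtTwoGenusPrimitiveSupplyAtTwoArchimedeanEggTwistLaw
import HarnessLib

/-!
# Route `GenusKolyvaginAtTwo`, crux #2 `GenusPrimitiveSupplyAtTwo` (stmt-BirchSwinnertonDyer-22136):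
# the cell's `-desc` packet BY NAME, UNCONDITIONALLY — T-A `AdmissibleTwistSelmerShiftAtTwo`, T-A′ `AdmissibleTwistSelmerLevelAtTwo`,
# T-C `EggTwistLawAtTwo`, T-V `StrictShaPropagationAtTwo` (`_holds`), no print item, no habitat hypothesis

Width seat `bsd-line-gk2-p4` g12 (cell `bsd-f1-sign2`), sequel of `…ArchimedeanFrame` (§70–§72: the T-A dichotomy with a single real
`T`-place for the CANONICAL identification, unconditional) and of gk2-p5's files 27/31 (`…ArchimedeanLevelLaw`, `…ArchimedeanEggTwistLaw`:
the rows on the habitat modulo {PT, Tate χ, Kramer parity}) and `…ArchimedeanRootNumber` (the rows by name modulo the PRINT route items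
{Modularity, 2-parity DD, Cassels–Tate}). THEOREMS ONLY (no definition, no named fact, no `sorry`); helper `--supports stmt-BirchSwinnertonDyer-22136`;
no item is closed; BSD is not proved by any of this.

WHAT. The four rows of the `-desc` packet `F1Sign2/DescentSignAtTwo.lean` carry the hypothesis `NoRationalTwoTorsion` (not `ρ̄_{W,2}` onto),
so they include the image-`C₃` curves where the typed `MazurRubin2010.kramerParity` is silent (its binder `huniq` fails). §72's dichotomy is
`huniq`-free (Kramer's congruence for the framed canonical identification, part 9), whence:

* §73 `natCard_selmerGroup_twist_eq_mul_two_of_descAdmissible_of_strict_frame`, `twistSelmerTwoCard_eq_two_mul_of_strict_frame` — UP for a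
  descent-admissible twist when `Sel₂(W)` is strict at `∞`, for EVERY globally minimal `W/ℚ` with `Δ_W > 0` (no parity fact, no image
  hypothesis; PT and Tate χ fed by tree theorems); `two_mul_twistSelmerTwoCard_eq_of_exists_unconditional` — DOWN likewise;
* §74 **`admissibleTwistSelmerShiftAtTwo_holds : AdmissibleTwistSelmerShiftAtTwo`** (T-A), **`admissibleTwistSelmerLevelAtTwo_holds`** (T-A′),
  **`eggTwistLawAtTwo_holds : EggTwistLawAtTwo`** (T-C), **`strictShaPropagationAtTwo_holds : StrictShaPropagationAtTwo`** (T-V) — the four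
  rows BY NAME with NO hypothesis left (Kramer 1981 Prop. 6 / Thm. 1 and Mazur–Rubin 2010 Cor. 3.4 (i) at `p = 2`, `T = {∞}`, kernel-checked
  from first principles: Poonen–Rains theta data, KMR Thm. 3.9, Poitou–Tate). The hypotheses `NoRationalTwoTorsion` (T-A, T-A′, T-V) and
  the rank hypothesis of T-V are not used; `not_descentSignNeg_iff_meetsEgg_unconditional` — the descent sign is the egg (`Δ > 0`,
  `E(ℚ)[2] = 0`, `Ш[2] = 0`), no print item.

Honest framing: support-grade cell rows (census T-A 808/808, T-A′ 50/50, T-C 375+65, T-V) become unconditional kernel theorems; beyond-print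
theorem: no (Kramer 1981); no item closed; crux 22136 stays OPEN at (U) ∧ (CONV₂); BSD is not proved by any of this.

References: [Kramer1981] §2 Prop. 6, Thm. 1; [MazurRubin2010] Thm. 2.7, Lemma 2.9, Prop. 3.3, Cor. 3.4 (i); [Monsky1996] Thm. 1.5;
[BrumerKramer1977] Prop. 3.7; [MilneADT2006] I Thm. 2.8, 2.13, 4.10.
-/

set_option linter.dupNamespace false -- tree convention: `Summit.BirchSwinnertonDyer.BirchSwinnertonDyer.Theorems` (summit = sub-problem)
set_option autoImplicit false

noncomputable section

open scoped Classical ContRepresentation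

namespace Summit.BirchSwinnertonDyer.BirchSwinnertonDyer.Theorems.GenusKolyArch

open WeierstrassCurve Field NumberField IsDedekindDomain Function
open Literature.NumberTheory.EllipticCurves Literature.NumberTheory.GaloisRepresentations
open Literature.NumberTheory.GaloisCohomology
open Summit.BirchSwinnertonDyer.Rank1Residual.F1Sign2
open Summit.BirchSwinnertonDyer.BirchSwinnertonDyer.Theorems.GenusKolyTwistLocal
open Summit.BirchSwinnertonDyer.BirchSwinnertonDyer.Theorems.SchneiderFreeAdditiveX3.PoitouTateReduction
  (poitouTate_selmerStructure_duality_real_holds)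

variable (W : WeierstrassCurve ℚ) [W.IsElliptic] [W.IsGloballyMinimal]

/-! ## §73 UP / DOWN for descent-admissible twists over `ℚ`, unconditional -/

/-- **UP for a descent-admissible twist when `Sel₂(W)` is strict at `∞` — UNCONDITIONAL** (no parity fact, no image hypothesis):
`W/ℚ` globally minimal elliptic with `Δ_W > 0`, `d` descent-admissible, `Wd = C • W^{(d)}`; if every class of `Sel₂(W)` localises to `0`
at the real place then `#Sel₂(Wd) = #Sel₂(W) · 2`. §72's framed UP with the menu of file 25 (`descAdmissible_place_menu`).
[cite: MazurRubin2010, Thm. 2.7, Lemma 2.9, Prop. 3.3, Cor. 3.4 (i)] [cite: Kramer1981, §2 Prop. 6, Thm. 1] -/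
theorem natCard_selmerGroup_twist_eq_mul_two_of_descAdmissible_of_strict_frame (hΔ : 0 < W.Δ)
    {d : ℤ} (hd : DescAdmissible W d) {Wd : WeierstrassCurve ℚ} [Wd.IsElliptic] {C : VariableChange ℚ}
    (hC : C • W.quadraticTwist (d : ℚ) = Wd)
    (hstrict : ∀ c ∈ (W.kummerSelmerStructure ((2 : ℕ) : ℤ)).selmerGroup,
      galoisCohomology.localization (W.torsionGaloisModule ((2 : ℕ) : ℤ)) (Sum.inl Rat.infinitePlace) 1 c = 0) :
    Nat.card (Wd.selmerGroup 2) = Nat.card (W.selmerGroup 2) * 2 := by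
  have hdneg : d < 0 := hd.1
  have hd0' : ((d : ℤ) : ℚ) ≠ 0 := by exact_mod_cast hdneg.ne
  have hEP : ∀ v : HeightOneSpectrum (𝓞 ℚ), localEulerPoincareCharacteristic (v.adicCompletion ℚ) := fun v ↦
    haveI : CharZero (v.adicCompletion ℚ) := charZero_of_injective_algebraMap (algebraMap ℚ _).injective
    localEulerPoincareCharacteristic_holds (v.adicCompletion ℚ)
  obtain ⟨φ, ψ, hψφ, hφψ, hsplit, hreal, π, A, hπ, hA⟩ := exists_intertwining_hsplit_and_transverse_inl_frame W hd0' hC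
  have hw₀ : (Rat.infinitePlace).IsReal := Rat.isReal_infinitePlace
  have hΔ' : 0 < InfinitePlace.embedding_of_isReal hw₀ W.Δ := by rwa [embedding_of_isReal_rat_apply, Rat.cast_pos]
  have hinf : ∀ w : InfinitePlace ℚ, w ≠ Rat.infinitePlace →
      (∃ s : w.Completion, s ^ 2 = algebraMap ℚ w.Completion ((d : ℤ) : ℚ)) ∨
      ((∀ x : galoisCohomology (W.localGaloisModule w.Completion) 1, x = 0) ∧
        (∀ x : galoisCohomology (Wd.localGaloisModule w.Completion) 1, x = 0)) :=
    fun w hw ↦ absurd (Subsingleton.elim w _) hw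
  have h := natCard_selmerGroup_twist_eq_mul_two_of_places_inl_of_frame W (poitouTate_selmerStructure_duality_real_holds (K := ℚ))
    hEP φ ψ hψφ hφψ π hπ A hA hsplit hw₀ hΔ' (descAdmissible_place_menu W hd hC φ ψ hψφ hφψ) hinf
    (hreal _ hw₀ hΔ' (forall_sq_ne_completion_of_neg (by exact_mod_cast hdneg) _)) hstrict
  simpa only [Nat.cast_ofNat] using h

/-- **UP in the cell's currency, unconditional**: `Δ_W > 0`, `Sel₂(W)` strict at `∞` ⟹ `#Sel₂(W^{(d)}) = 2·#Sel₂(W)` for every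
descent-admissible `d`. [cite: MazurRubin2010, Thm. 2.7, Cor. 3.4 (i)] [cite: Kramer1981, §2 Prop. 6, Thm. 1] -/
theorem twistSelmerTwoCard_eq_two_mul_of_strict_frame (hΔ : 0 < W.Δ)
    (hstrict : ∀ c ∈ (W.kummerSelmerStructure ((2 : ℕ) : ℤ)).selmerGroup,
      galoisCohomology.localization (W.torsionGaloisModule ((2 : ℕ) : ℤ)) (Sum.inl Rat.infinitePlace) 1 c = 0)
    {d : ℤ} (hd : DescAdmissible W d) :
    twistSelmerTwoCard W d = 2 * selmerTwoCard W := by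
  have hd0 : d ≠ 0 := hd.1.ne
  haveI := W.isElliptic_quadraticTwist (show ((d : ℤ) : ℚ) ≠ 0 by exact_mod_cast hd0)
  have hC : (1 : VariableChange ℚ) • W.quadraticTwist ((d : ℤ) : ℚ) = W.quadraticTwist ((d : ℤ) : ℚ) := one_smul _ _
  have h := natCard_selmerGroup_twist_eq_mul_two_of_descAdmissible_of_strict_frame W hΔ hd hC hstrict
  rw [GenusKolyTwin.natCard_selmerGroup_model_eq_twistSelmerTwoCard W hd0 _ ⟨1, hC⟩] at h
  rw [h, selmerTwoCard, mul_comm]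

/-- **DOWN in the cell's currency, unconditional** (gk2-p5's `two_mul_twistSelmerTwoCard_eq_of_exists` with PT and Tate χ fed by the tree
theorems): some class of `Sel₂(W)` non-trivial at `∞` ⟹ `2·#Sel₂(W^{(d)}) = #Sel₂(W)` for every descent-admissible `d`.
[cite: MazurRubin2010, Cor. 3.4 (i)] [cite: Kramer1981, §2 Prop. 6] [cite: MilneADT2006, I Thm. 2.8, 4.10] -/
theorem two_mul_twistSelmerTwoCard_eq_of_exists_unconditional (hΔ : 0 < W.Δ)
    (hns : ∃ c ∈ (W.kummerSelmerStructure ((2 : ℕ) : ℤ)).selmerGroup,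
      galoisCohomology.localization (W.torsionGaloisModule ((2 : ℕ) : ℤ)) (Sum.inl Rat.infinitePlace) 1 c ≠ 0)
    {d : ℤ} (hd : DescAdmissible W d) :
    2 * twistSelmerTwoCard W d = selmerTwoCard W :=
  two_mul_twistSelmerTwoCard_eq_of_exists W (poitouTate_selmerStructure_duality_real_holds (K := ℚ)) (GenusKolyLowering.localEP ℚ)
    hΔ hns hd

/-! ## §74 The four rows BY NAME, unconditionally -/

omit W in
/-- **T-A `F1Sign2.AdmissibleTwistSelmerShiftAtTwo` HOLDS** (Kramer 1981 Prop. 6 / Mazur–Rubin Cor. 3.4 (i) with `T = {∞}`; census 808/808):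
for every globally minimal elliptic `W/ℚ` with `Δ_W > 0` (and `E(ℚ)[2] = 0`, unused) and every descent-admissible `d`, `#Sel₂(W^{(d)})` is
`#Sel₂(W)/2` or `2·#Sel₂(W)` — DOWN iff some Selmer class is non-trivial at `∞`, UP iff `Sel₂(W)` is strict at `∞`. No hypothesis left:
PT, Tate χ and Kramer's congruence (for the framed canonical identification) are tree theorems.
[cite: Kramer1981, §2 Prop. 6, Thm. 1] [cite: MazurRubin2010, Thm. 2.7, Cor. 3.4 (i)] [cite: Monsky1996, Thm. 1.5] -/
theorem admissibleTwistSelmerShiftAtTwo_holds : AdmissibleTwistSelmerShiftAtTwo := by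
  intro W _ _ hΔ _ d hd
  by_cases hstrict : ∀ c ∈ (W.kummerSelmerStructure ((2 : ℕ) : ℤ)).selmerGroup,
      galoisCohomology.localization (W.torsionGaloisModule ((2 : ℕ) : ℤ)) (Sum.inl Rat.infinitePlace) 1 c = 0
  · exact Or.inr (twistSelmerTwoCard_eq_two_mul_of_strict_frame W hΔ hstrict hd)
  · push Not at hstrict
    obtain ⟨c, hc, hne⟩ := hstrict
    exact Or.inl (two_mul_twistSelmerTwoCard_eq_of_exists_unconditional W hΔ ⟨c, hc, hne⟩ hd)

omit W in
/-- **T-A′ `F1Sign2.AdmissibleTwistSelmerLevelAtTwo` HOLDS** (`d`-independence of `#Sel₂(W^{(d)})` = well-definedness of the descent sign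
`ε(W)`; census 50/50): for every globally minimal elliptic `W/ℚ` with `Δ_W > 0` and all descent-admissible `d, d'`,
`#Sel₂(W^{(d)}) = #Sel₂(W^{(d')})` — both `2·#Sel₂(W)` if `Sel₂(W)` is strict at `∞`, both `#Sel₂(W)/2` otherwise. Unconditional.
[cite: Kramer1981, §2 Prop. 6] [cite: MazurRubin2010, Thm. 2.7, Cor. 3.4 (i)] -/
theorem admissibleTwistSelmerLevelAtTwo_holds : AdmissibleTwistSelmerLevelAtTwo := by
  intro W _ _ hΔ _ d d' hd hd'
  by_cases hstrict : ∀ c ∈ (W.kummerSelmerStructure ((2 : ℕ) : ℤ)).selmerGroup,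
      galoisCohomology.localization (W.torsionGaloisModule ((2 : ℕ) : ℤ)) (Sum.inl Rat.infinitePlace) 1 c = 0
  · rw [twistSelmerTwoCard_eq_two_mul_of_strict_frame W hΔ hstrict hd,
      twistSelmerTwoCard_eq_two_mul_of_strict_frame W hΔ hstrict hd']
  · push Not at hstrict
    obtain ⟨c, hc, hne⟩ := hstrict
    have h1 := two_mul_twistSelmerTwoCard_eq_of_exists_unconditional W hΔ ⟨c, hc, hne⟩ hd
    have h2 := two_mul_twistSelmerTwoCard_eq_of_exists_unconditional W hΔ ⟨c, hc, hne⟩ hd'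
    omega

omit W in
/-- **T-C `F1Sign2.EggTwistLawAtTwo` HOLDS** (Kramer 1981 Prop. 6, rank one; census 375/375 + 65/65): for every globally minimal elliptic
`W/ℚ` with `Δ_W > 0`, `E(ℚ)[2] = 0`, Mordell–Weil rank `1`, `Ш(W)[2] = 0` and every descent-admissible `d`: if `E(ℚ)` meets the egg then
`#Sel₂(W^{(d)}) = 1`, and if `E(ℚ) ⊂ E⁰(ℝ)` then `#Sel₂(W^{(d)}) = 4`. DOWN is gk2-p5's `eggTwistLaw_meetsEgg`; UP is §73 with the
strictness at `∞` read off the egg (file 30 `forall_mem_selmerGroup_localization_inl_eq_zero_of_not_meetsEgg`) and `#Sel₂(W) = 2`. No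
habitat hypothesis, no parity fact. [cite: Kramer1981, §2 Prop. 6, Thm. 1] [cite: MazurRubin2010, Thm. 2.7, Cor. 3.4 (i)] [cite: BrumerKramer1977, Prop. 3.7] -/
theorem eggTwistLawAtTwo_holds : EggTwistLawAtTwo := by
  intro W _ _ hΔ hT hrank hSha d hd
  refine ⟨fun hegg ↦ eggTwistLaw_meetsEgg W hΔ hT hrank hSha hd hegg, fun hegg ↦ ?_⟩
  have h := twistSelmerTwoCard_eq_two_mul_of_strict_frame W hΔ
    (forall_mem_selmerGroup_localization_inl_eq_zero_of_not_meetsEgg W hΔ hT hSha hegg) hd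
  rw [selmerTwoCard_eq_two_of_rank_one W hT hrank hSha] at h
  exact h

omit W in
/-- **T-V `F1Sign2.StrictShaPropagationAtTwo` HOLDS** (the visibility dichotomy in cardinal form): for every globally minimal elliptic `W/ℚ`
with `Δ_W > 0` and `#Sel₂(W) = 4` (the hypotheses `E(ℚ)[2] = 0` and rank `0` are not used), EITHER every descent-admissible twist has
`#Sel₂ = 2` (some class of `Sel₂(W)` is non-trivial at `∞`) OR every descent-admissible twist has `#Sel₂ = 8` (`Sel₂(W)` strict at `∞`).
Unconditional. [cite: Kramer1981, §2 Prop. 6] [cite: MazurRubin2010, Thm. 2.7, Cor. 3.4 (i)] [cite: CremonaMazur2000, §3] -/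
theorem strictShaPropagationAtTwo_holds : StrictShaPropagationAtTwo := by
  intro W _ _ hΔ _ _ h4
  by_cases hstrict : ∀ c ∈ (W.kummerSelmerStructure ((2 : ℕ) : ℤ)).selmerGroup,
      galoisCohomology.localization (W.torsionGaloisModule ((2 : ℕ) : ℤ)) (Sum.inl Rat.infinitePlace) 1 c = 0
  · right
    intro d hd
    rw [twistSelmerTwoCard_eq_two_mul_of_strict_frame W hΔ hstrict hd, h4]
  · left
    push Not at hstrict
    obtain ⟨c, hc, hne⟩ := hstrict
    intro d hd
    have h := two_mul_twistSelmerTwoCard_eq_of_exists_unconditional W hΔ ⟨c, hc, hne⟩ hd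
    omega

omit W in
/-- **The descent sign is the egg — UNCONDITIONAL** (gk2-p5's `not_descentSignNeg_iff_meetsEgg_of_print` with the three print items
gone): for `W/ℚ` globally minimal elliptic with `Δ_W > 0`, `E(ℚ)[2] = 0`, `Ш(W)[2] = 0` and at least one descent-admissible `d`,
`¬ F1Sign2.DescentSignNeg W ↔ MeetsEgg W` — the cell's descent sign, defined through admissible twists, IS the real component of the
Mordell–Weil group. [cite: Kramer1981, §2 Prop. 6, Thm. 1] [cite: MazurRubin2010, Cor. 3.4 (i)] -/
theorem not_descentSignNeg_iff_meetsEgg_unconditional (W : WeierstrassCurve ℚ) [W.IsElliptic] [W.IsGloballyMinimal]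
    (hΔ : 0 < W.Δ) (hT : NoRationalTwoTorsion W) (hSha : ShaTwoTrivial W) (hex : ∃ d : ℤ, DescAdmissible W d) :
    ¬ DescentSignNeg W ↔ MeetsEgg W := by
  have h0 : selmerTwoCard W ≠ 0 := by
    rw [selmerTwoCard]
    haveI : Finite (W.selmerGroup 2) := W.finite_selmerGroup_holds (by norm_num)
    haveI : Nonempty (W.selmerGroup 2) := ⟨0⟩
    exact Nat.card_pos.ne'
  rw [meetsEgg_iff_exists_localization_inl_ne_zero W hΔ hT hSha]
  constructor
  · intro hns
    by_contra hstrict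
    push Not at hstrict
    obtain ⟨d, hd⟩ := hex
    exact hns ⟨d, hd, twistSelmerTwoCard_eq_two_mul_of_strict_frame W hΔ hstrict hd⟩
  · rintro ⟨c, hc, hne⟩ ⟨d, hd, h2⟩
    have h := two_mul_twistSelmerTwoCard_eq_of_exists_unconditional W hΔ ⟨c, hc, hne⟩ hd
    omega

end Summit.BirchSwinnertonDyer.BirchSwinnertonDyer.Theorems.GenusKolyArch

end
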